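/-
COR-CM (cell pub-hodgecm2, stage 2 of the Hodge ladder) — count-neutral KERNEL CENSUS TRANSPORT «the MARKMAN COLUMN», degree 12, type
`D₆` (`DihedralGroup 6`, `c = r 3`) — the dropped faces in the enlarged module (seat prover-pub-hodgecm2-b23-g34-0, binder prover b23, gen 34; own lane DEG12-MARKMAN-TRANSPORT,
HOME/LIT-CLAIMS.md l.1451, HOME/INBOX.md l.5632; seat b07's ORBIT-COUNT v2 §7.3/§7.4 offer by adjacency; sequel of
`Census/DuodecicFaceTransportDihedral.lean` (b23) on seat b09's DECIC-MARKMAN pattern `Census/DecicFaceTransportOfMarkman.lean`, generic part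
`CorCM/FaceCensusMarkmanColumn.lean`).  Theorems only; no definition, no named fact, nothing asserted; the census data `Γ` of
`Census/DuodecicFaceGeneratorsDihedral.lean` BY NAME; `Interfaces.lean` (C1), every E term, `B01/*`, `Transposition/*` untouched.
HONEST FRAMING (COORDINATOR RULING — HODGE FRAMING CORRECTION, 2026-08-21T11:55:35Z): `HC_CM` is NOT proved, here or anywhere in the
tree; nothing here produces a period or proves a case of the Hodge conjecture.
T5 (coordinator ruling 15:33:56Z (3)): binders = dictionary (e, hmul, hconj) + face/type READINGS (inhabited: `FaceCensus.exists_face_reads`,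
`FaceCensus.exists_type_reads`) + set memberships; no named fact, no Prop-valued supply binder; no contradiction derivable; checker: self, 2026-08-21.
-/
import Summits.HodgeConjecture.CorCM.Census.DuodecicFaceTransportDihedralOfMarkmanCerts
import Summits.HodgeConjecture.CorCM.FaceCensusMarkmanColumn
import HarnessLib

/-!
# Degree 12, type `D₆` (`DihedralGroup 6`, `c = r 3`): the dropped representatives lie in the ENLARGED module (certificates unwound)

For a Galois CM field `F` with an enumeration `e : GalT F ≃ Fin 12` multiplicative for b30's table (`e conjT = 3`), a base embedding `σ₀`, a set
`𝒮` of faces containing faces READING AS the kept representatives `(455;9,18)`, `(455;9,36)`, `(455;9,1152)`, `(469;9,36)`, CM types `E₀`, `E₁`, `T₁`, `T₂`, `T₃`, `T₄` of `F`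
reading as `2730`, `1386`, `952`, `3598`, `924`, `1806` and a set `𝒲` of families containing the relevant `![E_a, T]`: each face reading as a
dropped representative (`(455;9,576)`, `(455;18,36)`, `(455;18,1152)`, `(462;36,1152)`) has `weightRel f.corner (· ↦ {σ₀}) ∈ span ℤ Y(𝒮, 𝒲) ⊔ pairRel` — the kernel identities of
`Census/DuodecicFaceTransportDihedralOfMarkmanCerts.lean` unwound by `FaceCensus.mem_of_eval_eq_comboVal` (b23), the code evaluation of the two-slot weights
`FaceCensus.weightRel_pair_apply` and `FaceCensus.mem_known_of_sub_mem` (`CorCM/FaceCensusMarkmanColumn.lean`).  Consumed by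
`Census/DuodecicFaceTransportDihedralOfMarkman.lean` (the enlarged generation binder and the field closure).  `HC_CM` is NOT proved.

References: [cite: Pohlmann1968, Thm. 1]; [cite: Milne1999LefschetzClasses, Thm. 3.2].
-/

noncomputable section

open CategoryTheory NumberField NumberField.ComplexEmbedding
open Literature.AlgebraicGeometry Literature.AlgebraicGeometry.Motives Literature.AlgebraicGeometry.HodgeTheory
open Literature.AlgebraicGeometry.ComplexMultiplication Literature.AlgebraicGeometry.Milne1999
open Literature.NumberTheory.Automorphic Literature.NumberTheory.Automorphic.PicardCM
open Literature.NumberTheory.ComplexMultiplication.CMTypeOps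
open Summit.HodgeConjecture.CorCM.Prior.AllgGroup.RfwfAllgGroup
open Summit.HodgeConjecture.CorCM.Census.FaceSquaresModel
open Summit.HodgeConjecture.CorCM.Census.DuodecicFaceGeneratorsDihedral (Γ)
open Summit.HodgeConjecture.CorCM.FaceCensus
open Summit.HodgeConjecture.CorCM.Domination

namespace Summit.HodgeConjecture.CorCM.DuodecicFaceTransport.DihedralMarkman

/-! ## §2 The certificates unwound: the dropped faces lie in the enlarged module -/

section Model

variable {F : Type} [Field F] [NumberField F] [IsGalois ℚ F] (e : GalT F ≃ Fin 12)

/-- The KEPT representatives are read in `𝒮` (the `hreps` clause of `FaceCensus.mem_of_eval_eq_comboVal`). [folklore] -/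
theorem hreps_kept (σ₀ : F →+* ℂ) (𝒮 : Set (Face F)) (R₁ R₂ R₄ R₈ : Face F)
    (hR₁S : R₁ ∈ 𝒮) (hR₂S : R₂ ∈ 𝒮) (hR₄S : R₄ ∈ 𝒮) (hR₈S : R₈ ∈ 𝒮)
    (hR₁ : (∀ P : GalT F, P.1 σ₀ ∈ R₁.Φ.1 ↔ mem (e P) 455 = true) ∧
      Γ.placeMask (e (translate σ₀ R₁.p)) = 9 ∧ Γ.placeMask (e (translate σ₀ R₁.p')) = 18)
    (hR₂ : (∀ P : GalT F, P.1 σ₀ ∈ R₂.Φ.1 ↔ mem (e P) 455 = true) ∧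
      Γ.placeMask (e (translate σ₀ R₂.p)) = 9 ∧ Γ.placeMask (e (translate σ₀ R₂.p')) = 36)
    (hR₄ : (∀ P : GalT F, P.1 σ₀ ∈ R₄.Φ.1 ↔ mem (e P) 455 = true) ∧
      Γ.placeMask (e (translate σ₀ R₄.p)) = 9 ∧ Γ.placeMask (e (translate σ₀ R₄.p')) = 1152)
    (hR₈ : (∀ P : GalT F, P.1 σ₀ ∈ R₈.Φ.1 ↔ mem (e P) 469 = true) ∧
      Γ.placeMask (e (translate σ₀ R₈.p)) = 9 ∧ Γ.placeMask (e (translate σ₀ R₈.p')) = 36) :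
    ∀ r ∈ ([(455, 9, 18), (455, 9, 36), (455, 9, 1152), (469, 9, 36)] : List (ℕ × ℕ × ℕ)), ∃ R ∈ 𝒮, (r.1 < 2 ^ 12 ∧ ∀ i : Fin 12, mem i r.1 = true ↔ e.symm i ∈ (pullType R.Φ σ₀).1) ∧
      Γ.placeMask (e (translate σ₀ R.p)) = r.2.1 ∧ Γ.placeMask (e (translate σ₀ R.p')) = r.2.2 := by
  intro r hr
  simp only [List.mem_cons, List.not_mem_nil, or_false] at hr
  rcases hr with rfl | rfl | rfl | rfl
  · exact hreps_of_reads Γ e σ₀ 𝒮 hR₁S (by norm_num) hR₁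
  · exact hreps_of_reads Γ e σ₀ 𝒮 hR₂S (by norm_num) hR₂
  · exact hreps_of_reads Γ e σ₀ 𝒮 hR₄S (by norm_num) hR₄
  · exact hreps_of_reads Γ e σ₀ 𝒮 hR₈S (by norm_num) hR₈

open scoped Classical in
/-- **The dropped face `(455;9,576)` lies in the enlarged module** (pre-quotient, at the base embedding): for a face `R` of `F` reading as
`(455;9,576)` at `σ₀` (code form), any `𝒮` containing faces reading as the kept representatives and any `𝒲` containing the families of the
weights used by `cert_R₃`:  `weightRel R.corner (· ↦ {σ₀}) ∈ span ℤ Y(𝒮, 𝒲) ⊔ pairRel`. [cite: Pohlmann1968, Thm. 1] -/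
theorem weightRel_R₃_mem_span_known (hmul : ∀ P Q : GalT F, e (P * Q) = Γ.mul (e P) (e Q)) (hconj : e conjT = Γ.conj)
    (σ₀ : F →+* ℂ) (𝒮 : Set (Face F)) (𝒲 : Set ((m : ℕ) × (Fin (m + 1) → CMType F))) (R₁ R₂ R₄ R₈ : Face F)
    (hR₁S : R₁ ∈ 𝒮) (hR₂S : R₂ ∈ 𝒮) (hR₄S : R₄ ∈ 𝒮) (hR₈S : R₈ ∈ 𝒮)
    (hR₁ : (∀ P : GalT F, P.1 σ₀ ∈ R₁.Φ.1 ↔ mem (e P) 455 = true) ∧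
      Γ.placeMask (e (translate σ₀ R₁.p)) = 9 ∧ Γ.placeMask (e (translate σ₀ R₁.p')) = 18)
    (hR₂ : (∀ P : GalT F, P.1 σ₀ ∈ R₂.Φ.1 ↔ mem (e P) 455 = true) ∧
      Γ.placeMask (e (translate σ₀ R₂.p)) = 9 ∧ Γ.placeMask (e (translate σ₀ R₂.p')) = 36)
    (hR₄ : (∀ P : GalT F, P.1 σ₀ ∈ R₄.Φ.1 ↔ mem (e P) 455 = true) ∧
      Γ.placeMask (e (translate σ₀ R₄.p)) = 9 ∧ Γ.placeMask (e (translate σ₀ R₄.p')) = 1152)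
    (hR₈ : (∀ P : GalT F, P.1 σ₀ ∈ R₈.Φ.1 ↔ mem (e P) 469 = true) ∧
      Γ.placeMask (e (translate σ₀ R₈.p)) = 9 ∧ Γ.placeMask (e (translate σ₀ R₈.p')) = 36)
    (R : Face F) (hR : (455 < 2 ^ 12 ∧ ∀ i : Fin 12, mem i 455 = true ↔ e.symm i ∈ (pullType R.Φ σ₀).1) ∧
      Γ.placeMask (e (translate σ₀ R.p)) = 9 ∧ Γ.placeMask (e (translate σ₀ R.p')) = 576)
    (E₁ T₃ T₄ : CMType F)
    (hE₁ : (∀ P : GalT F, P.1 σ₀ ∈ E₁.1 ↔ mem (e P) 1386 = true))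
    (hT₃ : (∀ P : GalT F, P.1 σ₀ ∈ T₃.1 ↔ mem (e P) 924 = true))
    (hT₄ : (∀ P : GalT F, P.1 σ₀ ∈ T₄.1 ↔ mem (e P) 1806 = true))
    (hW₃ : (⟨1, ![E₁, T₃]⟩ : (m : ℕ) × (Fin (m + 1) → CMType F)) ∈ 𝒲)
    (hW₄ : (⟨1, ![E₁, T₄]⟩ : (m : ℕ) × (Fin (m + 1) → CMType F)) ∈ 𝒲) :
    weightRel R.corner (fun _ => ({σ₀} : Finset (F →+* ℂ))) ∈
      Submodule.span ℤ {y : CMF (GalT F) conjT →₀ ℤ |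
        (∃ g ∈ 𝒮, ∃ σ : F →+* ℂ, y = weightRel g.corner (fun _ => ({σ} : Finset (F →+* ℂ)))) ∨
        ∃ w ∈ 𝒲, ∃ (p' : ℕ) (S' : Fin (w.1 + 1) → Finset (F →+* ℂ)), IsHodgeWeight w.2 p' S' ∧ y = weightRel w.2 S'}
        ⊔ pairRel := by
  have hxy : weightRel R.corner (fun _ => ({σ₀} : Finset (F →+* ℂ))) -
      ((1 : ℤ) • weightRel ![E₁, T₃] ![(([0] : List (Fin 12)).map fun u => ((e.symm u)⁻¹).1 σ₀).toFinset, (([0, 4, 2] : List (Fin 12)).map fun u => ((e.symm u)⁻¹).1 σ₀).toFinset] + (-1 : ℤ) • weightRel ![E₁, T₄] ![(([0] : List (Fin 12)).map fun u => ((e.symm u)⁻¹).1 σ₀).toFinset, (([5, 3, 1] : List (Fin 12)).map fun u => ((e.symm u)⁻¹).1 σ₀).toFinset]) ∈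
      Submodule.span ℤ {y : CMF (GalT F) conjT →₀ ℤ | ∃ g ∈ 𝒮, ∃ σ : F →+* ℂ,
        y = weightRel g.corner (fun _ => ({σ} : Finset (F →+* ℂ)))} ⊔ pairRel := by
    refine mem_of_eval_eq_comboVal Γ e hmul hconj σ₀ 𝒮 [(455, 9, 18), (455, 9, 36), (455, 9, 1152), (469, 9, 36)]
      (hreps_kept e σ₀ 𝒮 R₁ R₂ R₄ R₈ hR₁S hR₂S hR₄S hR₈S hR₁ hR₂ hR₄ hR₈)
      [((476, 18, 9), 1), ((924, 576, 1152), -1), ((3171, 1152, 576), -1), ((3640, 9, 18), 1), ((3640, 1152, 2304), -1),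
        ((1400, 576, 36), 1), ((3171, 36, 18), 1), ((1400, 2304, 576), -1), ((910, 36, 576), -1), ((455, 1152, 9), -1),
        ((1358, 576, 1152), 1), ((455, 9, 36), 1), ((1372, 576, 36), 1), ((2695, 2304, 576), -1)]
      [(455, 1), (462, -1), (469, -1), (903, 2), (1351, 1)]
      (cells_of_check Γ _ _ checks_R₃.1) (pairs_of_check Γ _ checks_R₃.2) _ fun Ψ S hS => ?_
    rw [Finsupp.sub_apply, Finsupp.add_apply, Finsupp.smul_apply, Finsupp.smul_apply, smul_eq_mul]
    rw [weightRel_corner_apply Γ e hmul hconj R σ₀ hR.1 Ψ hS,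
      hR.2.1,
      hR.2.2,
      weightRel_pair_apply Γ e hmul σ₀ E₁ T₃ (by norm_num) (by norm_num) hE₁ hT₃ _ _ hodgeCheck_W₃.1 Ψ hS,
      weightRel_pair_apply Γ e hmul σ₀ E₁ T₄ (by norm_num) (by norm_num) hE₁ hT₄ _ _ hodgeCheck_W₄.1 Ψ hS]
    exact cert_R₃ S (code_mem_cmTypes Γ e hmul hconj hS)
  exact mem_known_of_sub_mem 𝒮 𝒲 hxy
    (Submodule.add_mem _ (zsmul_weightRel_mem_known 𝒮 𝒲 hW₃
        (isHodgeWeight_pair_of_check Γ e hmul σ₀ E₁ T₃ (by norm_num) (by norm_num) hE₁ hT₃ _ _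
          hodgeCheck_W₃.1 hodgeCheck_W₃.2.1 hodgeCheck_W₃.2.2) (1 : ℤ))
      (zsmul_weightRel_mem_known 𝒮 𝒲 hW₄
        (isHodgeWeight_pair_of_check Γ e hmul σ₀ E₁ T₄ (by norm_num) (by norm_num) hE₁ hT₄ _ _
          hodgeCheck_W₄.1 hodgeCheck_W₄.2.1 hodgeCheck_W₄.2.2) (-1 : ℤ)))

open scoped Classical in
/-- **The dropped face `(455;18,36)` lies in the enlarged module** (pre-quotient, at the base embedding): for a face `R` of `F` reading as
`(455;18,36)` at `σ₀` (code form), any `𝒮` containing faces reading as the kept representatives and any `𝒲` containing the families of the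
weights used by `cert_R₅`:  `weightRel R.corner (· ↦ {σ₀}) ∈ span ℤ Y(𝒮, 𝒲) ⊔ pairRel`. [cite: Pohlmann1968, Thm. 1] -/
theorem weightRel_R₅_mem_span_known (hmul : ∀ P Q : GalT F, e (P * Q) = Γ.mul (e P) (e Q)) (hconj : e conjT = Γ.conj)
    (σ₀ : F →+* ℂ) (𝒮 : Set (Face F)) (𝒲 : Set ((m : ℕ) × (Fin (m + 1) → CMType F))) (R₁ R₂ R₄ R₈ : Face F)
    (hR₁S : R₁ ∈ 𝒮) (hR₂S : R₂ ∈ 𝒮) (hR₄S : R₄ ∈ 𝒮) (hR₈S : R₈ ∈ 𝒮)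
    (hR₁ : (∀ P : GalT F, P.1 σ₀ ∈ R₁.Φ.1 ↔ mem (e P) 455 = true) ∧
      Γ.placeMask (e (translate σ₀ R₁.p)) = 9 ∧ Γ.placeMask (e (translate σ₀ R₁.p')) = 18)
    (hR₂ : (∀ P : GalT F, P.1 σ₀ ∈ R₂.Φ.1 ↔ mem (e P) 455 = true) ∧
      Γ.placeMask (e (translate σ₀ R₂.p)) = 9 ∧ Γ.placeMask (e (translate σ₀ R₂.p')) = 36)
    (hR₄ : (∀ P : GalT F, P.1 σ₀ ∈ R₄.Φ.1 ↔ mem (e P) 455 = true) ∧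
      Γ.placeMask (e (translate σ₀ R₄.p)) = 9 ∧ Γ.placeMask (e (translate σ₀ R₄.p')) = 1152)
    (hR₈ : (∀ P : GalT F, P.1 σ₀ ∈ R₈.Φ.1 ↔ mem (e P) 469 = true) ∧
      Γ.placeMask (e (translate σ₀ R₈.p)) = 9 ∧ Γ.placeMask (e (translate σ₀ R₈.p')) = 36)
    (R : Face F) (hR : (455 < 2 ^ 12 ∧ ∀ i : Fin 12, mem i 455 = true ↔ e.symm i ∈ (pullType R.Φ σ₀).1) ∧
      Γ.placeMask (e (translate σ₀ R.p)) = 18 ∧ Γ.placeMask (e (translate σ₀ R.p')) = 36)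
    (E₀ E₁ T₁ T₂ T₃ T₄ : CMType F)
    (hE₀ : (∀ P : GalT F, P.1 σ₀ ∈ E₀.1 ↔ mem (e P) 2730 = true))
    (hE₁ : (∀ P : GalT F, P.1 σ₀ ∈ E₁.1 ↔ mem (e P) 1386 = true))
    (hT₁ : (∀ P : GalT F, P.1 σ₀ ∈ T₁.1 ↔ mem (e P) 952 = true))
    (hT₂ : (∀ P : GalT F, P.1 σ₀ ∈ T₂.1 ↔ mem (e P) 3598 = true))
    (hT₃ : (∀ P : GalT F, P.1 σ₀ ∈ T₃.1 ↔ mem (e P) 924 = true))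
    (hT₄ : (∀ P : GalT F, P.1 σ₀ ∈ T₄.1 ↔ mem (e P) 1806 = true))
    (hW₁ : (⟨1, ![E₀, T₁]⟩ : (m : ℕ) × (Fin (m + 1) → CMType F)) ∈ 𝒲)
    (hW₂ : (⟨1, ![E₀, T₂]⟩ : (m : ℕ) × (Fin (m + 1) → CMType F)) ∈ 𝒲)
    (hW₃ : (⟨1, ![E₁, T₃]⟩ : (m : ℕ) × (Fin (m + 1) → CMType F)) ∈ 𝒲)
    (hW₄ : (⟨1, ![E₁, T₄]⟩ : (m : ℕ) × (Fin (m + 1) → CMType F)) ∈ 𝒲) :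
    weightRel R.corner (fun _ => ({σ₀} : Finset (F →+* ℂ))) ∈
      Submodule.span ℤ {y : CMF (GalT F) conjT →₀ ℤ |
        (∃ g ∈ 𝒮, ∃ σ : F →+* ℂ, y = weightRel g.corner (fun _ => ({σ} : Finset (F →+* ℂ)))) ∨
        ∃ w ∈ 𝒲, ∃ (p' : ℕ) (S' : Fin (w.1 + 1) → Finset (F →+* ℂ)), IsHodgeWeight w.2 p' S' ∧ y = weightRel w.2 S'}
        ⊔ pairRel := by
  have hxy : weightRel R.corner (fun _ => ({σ₀} : Finset (F →+* ℂ))) -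
      ((-1 : ℤ) • weightRel ![E₀, T₁] ![(([0] : List (Fin 12)).map fun u => ((e.symm u)⁻¹).1 σ₀).toFinset, (([5, 1, 3] : List (Fin 12)).map fun u => ((e.symm u)⁻¹).1 σ₀).toFinset] + (1 : ℤ) • weightRel ![E₀, T₂] ![(([0] : List (Fin 12)).map fun u => ((e.symm u)⁻¹).1 σ₀).toFinset, (([3, 5, 1] : List (Fin 12)).map fun u => ((e.symm u)⁻¹).1 σ₀).toFinset] + (-1 : ℤ) • weightRel ![E₁, T₃] ![(([0] : List (Fin 12)).map fun u => ((e.symm u)⁻¹).1 σ₀).toFinset, (([0, 4, 2] : List (Fin 12)).map fun u => ((e.symm u)⁻¹).1 σ₀).toFinset] + (1 : ℤ) • weightRel ![E₁, T₄] ![(([0] : List (Fin 12)).map fun u => ((e.symm u)⁻¹).1 σ₀).toFinset, (([5, 3, 1] : List (Fin 12)).map fun u => ((e.symm u)⁻¹).1 σ₀).toFinset]) ∈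
      Submodule.span ℤ {y : CMF (GalT F) conjT →₀ ℤ | ∃ g ∈ 𝒮, ∃ σ : F →+* ℂ,
        y = weightRel g.corner (fun _ => ({σ} : Finset (F →+* ℂ)))} ⊔ pairRel := by
    refine mem_of_eval_eq_comboVal Γ e hmul hconj σ₀ 𝒮 [(455, 9, 18), (455, 9, 36), (455, 9, 1152), (469, 9, 36)]
      (hreps_kept e σ₀ 𝒮 R₁ R₂ R₄ R₈ hR₁S hR₂S hR₄S hR₈S hR₁ hR₂ hR₄ hR₈)
      [((1820, 18, 36), -1), ((2247, 18, 2304), 1), ((476, 18, 9), 2), ((945, 576, 1152), 1), ((924, 1152, 2304), 1),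
        ((1393, 576, 2304), -1), ((924, 576, 1152), -1), ((3640, 36, 9), 1), ((3143, 18, 36), 2), ((3171, 1152, 576), -1),
        ((1400, 576, 36), 1), ((3171, 36, 18), 1), ((1400, 2304, 576), -1), ((1820, 36, 9), 1), ((1841, 36, 18), -1),
        ((924, 18, 2304), -1), ((3164, 18, 9), -1), ((3605, 576, 36), -1), ((1841, 576, 1152), 1), ((3150, 18, 9), -1),
        ((1372, 1152, 2304), 1)]
      [(455, -1), (469, -1), (483, -1), (497, -1)]
      (cells_of_check Γ _ _ checks_R₅.1) (pairs_of_check Γ _ checks_R₅.2) _ fun Ψ S hS => ?_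
    rw [Finsupp.sub_apply, Finsupp.add_apply, Finsupp.add_apply, Finsupp.add_apply, Finsupp.smul_apply, Finsupp.smul_apply, Finsupp.smul_apply, Finsupp.smul_apply, smul_eq_mul]
    rw [weightRel_corner_apply Γ e hmul hconj R σ₀ hR.1 Ψ hS,
      hR.2.1,
      hR.2.2,
      weightRel_pair_apply Γ e hmul σ₀ E₀ T₁ (by norm_num) (by norm_num) hE₀ hT₁ _ _ hodgeCheck_W₁.1 Ψ hS,
      weightRel_pair_apply Γ e hmul σ₀ E₀ T₂ (by norm_num) (by norm_num) hE₀ hT₂ _ _ hodgeCheck_W₂.1 Ψ hS,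
      weightRel_pair_apply Γ e hmul σ₀ E₁ T₃ (by norm_num) (by norm_num) hE₁ hT₃ _ _ hodgeCheck_W₃.1 Ψ hS,
      weightRel_pair_apply Γ e hmul σ₀ E₁ T₄ (by norm_num) (by norm_num) hE₁ hT₄ _ _ hodgeCheck_W₄.1 Ψ hS]
    exact cert_R₅ S (code_mem_cmTypes Γ e hmul hconj hS)
  exact mem_known_of_sub_mem 𝒮 𝒲 hxy
    (Submodule.add_mem _ (Submodule.add_mem _ (Submodule.add_mem _ (zsmul_weightRel_mem_known 𝒮 𝒲 hW₁
        (isHodgeWeight_pair_of_check Γ e hmul σ₀ E₀ T₁ (by norm_num) (by norm_num) hE₀ hT₁ _ _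
          hodgeCheck_W₁.1 hodgeCheck_W₁.2.1 hodgeCheck_W₁.2.2) (-1 : ℤ))
      (zsmul_weightRel_mem_known 𝒮 𝒲 hW₂
        (isHodgeWeight_pair_of_check Γ e hmul σ₀ E₀ T₂ (by norm_num) (by norm_num) hE₀ hT₂ _ _
          hodgeCheck_W₂.1 hodgeCheck_W₂.2.1 hodgeCheck_W₂.2.2) (1 : ℤ)))
      (zsmul_weightRel_mem_known 𝒮 𝒲 hW₃
        (isHodgeWeight_pair_of_check Γ e hmul σ₀ E₁ T₃ (by norm_num) (by norm_num) hE₁ hT₃ _ _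
          hodgeCheck_W₃.1 hodgeCheck_W₃.2.1 hodgeCheck_W₃.2.2) (-1 : ℤ)))
      (zsmul_weightRel_mem_known 𝒮 𝒲 hW₄
        (isHodgeWeight_pair_of_check Γ e hmul σ₀ E₁ T₄ (by norm_num) (by norm_num) hE₁ hT₄ _ _
          hodgeCheck_W₄.1 hodgeCheck_W₄.2.1 hodgeCheck_W₄.2.2) (1 : ℤ)))

open scoped Classical in
/-- **The dropped face `(455;18,1152)` lies in the enlarged module** (pre-quotient, at the base embedding): for a face `R` of `F` reading as
`(455;18,1152)` at `σ₀` (code form), any `𝒮` containing faces reading as the kept representatives and any `𝒲` containing the families of the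
weights used by `cert_R₆`:  `weightRel R.corner (· ↦ {σ₀}) ∈ span ℤ Y(𝒮, 𝒲) ⊔ pairRel`. [cite: Pohlmann1968, Thm. 1] -/
theorem weightRel_R₆_mem_span_known (hmul : ∀ P Q : GalT F, e (P * Q) = Γ.mul (e P) (e Q)) (hconj : e conjT = Γ.conj)
    (σ₀ : F →+* ℂ) (𝒮 : Set (Face F)) (𝒲 : Set ((m : ℕ) × (Fin (m + 1) → CMType F))) (R₁ R₂ R₄ R₈ : Face F)
    (hR₁S : R₁ ∈ 𝒮) (hR₂S : R₂ ∈ 𝒮) (hR₄S : R₄ ∈ 𝒮) (hR₈S : R₈ ∈ 𝒮)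
    (hR₁ : (∀ P : GalT F, P.1 σ₀ ∈ R₁.Φ.1 ↔ mem (e P) 455 = true) ∧
      Γ.placeMask (e (translate σ₀ R₁.p)) = 9 ∧ Γ.placeMask (e (translate σ₀ R₁.p')) = 18)
    (hR₂ : (∀ P : GalT F, P.1 σ₀ ∈ R₂.Φ.1 ↔ mem (e P) 455 = true) ∧
      Γ.placeMask (e (translate σ₀ R₂.p)) = 9 ∧ Γ.placeMask (e (translate σ₀ R₂.p')) = 36)
    (hR₄ : (∀ P : GalT F, P.1 σ₀ ∈ R₄.Φ.1 ↔ mem (e P) 455 = true) ∧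
      Γ.placeMask (e (translate σ₀ R₄.p)) = 9 ∧ Γ.placeMask (e (translate σ₀ R₄.p')) = 1152)
    (hR₈ : (∀ P : GalT F, P.1 σ₀ ∈ R₈.Φ.1 ↔ mem (e P) 469 = true) ∧
      Γ.placeMask (e (translate σ₀ R₈.p)) = 9 ∧ Γ.placeMask (e (translate σ₀ R₈.p')) = 36)
    (R : Face F) (hR : (455 < 2 ^ 12 ∧ ∀ i : Fin 12, mem i 455 = true ↔ e.symm i ∈ (pullType R.Φ σ₀).1) ∧
      Γ.placeMask (e (translate σ₀ R.p)) = 18 ∧ Γ.placeMask (e (translate σ₀ R.p')) = 1152)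
    (E₀ E₁ T₁ T₃ T₄ : CMType F)
    (hE₀ : (∀ P : GalT F, P.1 σ₀ ∈ E₀.1 ↔ mem (e P) 2730 = true))
    (hE₁ : (∀ P : GalT F, P.1 σ₀ ∈ E₁.1 ↔ mem (e P) 1386 = true))
    (hT₁ : (∀ P : GalT F, P.1 σ₀ ∈ T₁.1 ↔ mem (e P) 952 = true))
    (hT₃ : (∀ P : GalT F, P.1 σ₀ ∈ T₃.1 ↔ mem (e P) 924 = true))
    (hT₄ : (∀ P : GalT F, P.1 σ₀ ∈ T₄.1 ↔ mem (e P) 1806 = true))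
    (hW₁ : (⟨1, ![E₀, T₁]⟩ : (m : ℕ) × (Fin (m + 1) → CMType F)) ∈ 𝒲)
    (hW₃ : (⟨1, ![E₁, T₃]⟩ : (m : ℕ) × (Fin (m + 1) → CMType F)) ∈ 𝒲)
    (hW₄ : (⟨1, ![E₁, T₄]⟩ : (m : ℕ) × (Fin (m + 1) → CMType F)) ∈ 𝒲) :
    weightRel R.corner (fun _ => ({σ₀} : Finset (F →+* ℂ))) ∈
      Submodule.span ℤ {y : CMF (GalT F) conjT →₀ ℤ |
        (∃ g ∈ 𝒮, ∃ σ : F →+* ℂ, y = weightRel g.corner (fun _ => ({σ} : Finset (F →+* ℂ)))) ∨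
        ∃ w ∈ 𝒲, ∃ (p' : ℕ) (S' : Fin (w.1 + 1) → Finset (F →+* ℂ)), IsHodgeWeight w.2 p' S' ∧ y = weightRel w.2 S'}
        ⊔ pairRel := by
  have hxy : weightRel R.corner (fun _ => ({σ₀} : Finset (F →+* ℂ))) -
      ((-1 : ℤ) • weightRel ![E₀, T₁] ![(([0] : List (Fin 12)).map fun u => ((e.symm u)⁻¹).1 σ₀).toFinset, (([5, 1, 3] : List (Fin 12)).map fun u => ((e.symm u)⁻¹).1 σ₀).toFinset] + (-1 : ℤ) • weightRel ![E₁, T₃] ![(([0] : List (Fin 12)).map fun u => ((e.symm u)⁻¹).1 σ₀).toFinset, (([0, 4, 2] : List (Fin 12)).map fun u => ((e.symm u)⁻¹).1 σ₀).toFinset] + (1 : ℤ) • weightRel ![E₁, T₄] ![(([0] : List (Fin 12)).map fun u => ((e.symm u)⁻¹).1 σ₀).toFinset, (([5, 3, 1] : List (Fin 12)).map fun u => ((e.symm u)⁻¹).1 σ₀).toFinset]) ∈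
      Submodule.span ℤ {y : CMF (GalT F) conjT →₀ ℤ | ∃ g ∈ 𝒮, ∃ σ : F →+* ℂ,
        y = weightRel g.corner (fun _ => ({σ} : Finset (F →+* ℂ)))} ⊔ pairRel := by
    refine mem_of_eval_eq_comboVal Γ e hmul hconj σ₀ 𝒮 [(455, 9, 18), (455, 9, 36), (455, 9, 1152), (469, 9, 36)]
      (hreps_kept e σ₀ 𝒮 R₁ R₂ R₄ R₈ hR₁S hR₂S hR₄S hR₈S hR₁ hR₂ hR₄ hR₈)
      [((476, 18, 9), 1), ((3640, 36, 9), 1), ((3143, 18, 36), 1), ((1820, 36, 9), 1), ((3171, 18, 9), 1), ((1820, 9, 1152), -1),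
        ((3605, 576, 36), -1), ((455, 1152, 9), 1), ((1358, 576, 1152), -1)]
      [(455, -1), (483, -1), (903, -1), (1365, 1)]
      (cells_of_check Γ _ _ checks_R₆.1) (pairs_of_check Γ _ checks_R₆.2) _ fun Ψ S hS => ?_
    rw [Finsupp.sub_apply, Finsupp.add_apply, Finsupp.add_apply, Finsupp.smul_apply, Finsupp.smul_apply, Finsupp.smul_apply, smul_eq_mul]
    rw [weightRel_corner_apply Γ e hmul hconj R σ₀ hR.1 Ψ hS,
      hR.2.1,
      hR.2.2,
      weightRel_pair_apply Γ e hmul σ₀ E₀ T₁ (by norm_num) (by norm_num) hE₀ hT₁ _ _ hodgeCheck_W₁.1 Ψ hS,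
      weightRel_pair_apply Γ e hmul σ₀ E₁ T₃ (by norm_num) (by norm_num) hE₁ hT₃ _ _ hodgeCheck_W₃.1 Ψ hS,
      weightRel_pair_apply Γ e hmul σ₀ E₁ T₄ (by norm_num) (by norm_num) hE₁ hT₄ _ _ hodgeCheck_W₄.1 Ψ hS]
    exact cert_R₆ S (code_mem_cmTypes Γ e hmul hconj hS)
  exact mem_known_of_sub_mem 𝒮 𝒲 hxy
    (Submodule.add_mem _ (Submodule.add_mem _ (zsmul_weightRel_mem_known 𝒮 𝒲 hW₁
        (isHodgeWeight_pair_of_check Γ e hmul σ₀ E₀ T₁ (by norm_num) (by norm_num) hE₀ hT₁ _ _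
          hodgeCheck_W₁.1 hodgeCheck_W₁.2.1 hodgeCheck_W₁.2.2) (-1 : ℤ))
      (zsmul_weightRel_mem_known 𝒮 𝒲 hW₃
        (isHodgeWeight_pair_of_check Γ e hmul σ₀ E₁ T₃ (by norm_num) (by norm_num) hE₁ hT₃ _ _
          hodgeCheck_W₃.1 hodgeCheck_W₃.2.1 hodgeCheck_W₃.2.2) (-1 : ℤ)))
      (zsmul_weightRel_mem_known 𝒮 𝒲 hW₄
        (isHodgeWeight_pair_of_check Γ e hmul σ₀ E₁ T₄ (by norm_num) (by norm_num) hE₁ hT₄ _ _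
          hodgeCheck_W₄.1 hodgeCheck_W₄.2.1 hodgeCheck_W₄.2.2) (1 : ℤ)))

open scoped Classical in
/-- **The dropped face `(462;36,1152)` lies in the enlarged module** (pre-quotient, at the base embedding): for a face `R` of `F` reading as
`(462;36,1152)` at `σ₀` (code form), any `𝒮` containing faces reading as the kept representatives and any `𝒲` containing the families of the
weights used by `cert_R₇`:  `weightRel R.corner (· ↦ {σ₀}) ∈ span ℤ Y(𝒮, 𝒲) ⊔ pairRel`. [cite: Pohlmann1968, Thm. 1] -/
theorem weightRel_R₇_mem_span_known (hmul : ∀ P Q : GalT F, e (P * Q) = Γ.mul (e P) (e Q)) (hconj : e conjT = Γ.conj)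
    (σ₀ : F →+* ℂ) (𝒮 : Set (Face F)) (𝒲 : Set ((m : ℕ) × (Fin (m + 1) → CMType F))) (R₁ R₂ R₄ R₈ : Face F)
    (hR₁S : R₁ ∈ 𝒮) (hR₂S : R₂ ∈ 𝒮) (hR₄S : R₄ ∈ 𝒮) (hR₈S : R₈ ∈ 𝒮)
    (hR₁ : (∀ P : GalT F, P.1 σ₀ ∈ R₁.Φ.1 ↔ mem (e P) 455 = true) ∧
      Γ.placeMask (e (translate σ₀ R₁.p)) = 9 ∧ Γ.placeMask (e (translate σ₀ R₁.p')) = 18)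
    (hR₂ : (∀ P : GalT F, P.1 σ₀ ∈ R₂.Φ.1 ↔ mem (e P) 455 = true) ∧
      Γ.placeMask (e (translate σ₀ R₂.p)) = 9 ∧ Γ.placeMask (e (translate σ₀ R₂.p')) = 36)
    (hR₄ : (∀ P : GalT F, P.1 σ₀ ∈ R₄.Φ.1 ↔ mem (e P) 455 = true) ∧
      Γ.placeMask (e (translate σ₀ R₄.p)) = 9 ∧ Γ.placeMask (e (translate σ₀ R₄.p')) = 1152)
    (hR₈ : (∀ P : GalT F, P.1 σ₀ ∈ R₈.Φ.1 ↔ mem (e P) 469 = true) ∧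
      Γ.placeMask (e (translate σ₀ R₈.p)) = 9 ∧ Γ.placeMask (e (translate σ₀ R₈.p')) = 36)
    (R : Face F) (hR : (462 < 2 ^ 12 ∧ ∀ i : Fin 12, mem i 462 = true ↔ e.symm i ∈ (pullType R.Φ σ₀).1) ∧
      Γ.placeMask (e (translate σ₀ R.p)) = 36 ∧ Γ.placeMask (e (translate σ₀ R.p')) = 1152)
    (E₁ T₃ : CMType F)
    (hE₁ : (∀ P : GalT F, P.1 σ₀ ∈ E₁.1 ↔ mem (e P) 1386 = true))
    (hT₃ : (∀ P : GalT F, P.1 σ₀ ∈ T₃.1 ↔ mem (e P) 924 = true))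
    (hW₃ : (⟨1, ![E₁, T₃]⟩ : (m : ℕ) × (Fin (m + 1) → CMType F)) ∈ 𝒲) :
    weightRel R.corner (fun _ => ({σ₀} : Finset (F →+* ℂ))) ∈
      Submodule.span ℤ {y : CMF (GalT F) conjT →₀ ℤ |
        (∃ g ∈ 𝒮, ∃ σ : F →+* ℂ, y = weightRel g.corner (fun _ => ({σ} : Finset (F →+* ℂ)))) ∨
        ∃ w ∈ 𝒲, ∃ (p' : ℕ) (S' : Fin (w.1 + 1) → Finset (F →+* ℂ)), IsHodgeWeight w.2 p' S' ∧ y = weightRel w.2 S'}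
        ⊔ pairRel := by
  have hxy : weightRel R.corner (fun _ => ({σ₀} : Finset (F →+* ℂ))) -
      ((1 : ℤ) • weightRel ![E₁, T₃] ![(([0] : List (Fin 12)).map fun u => ((e.symm u)⁻¹).1 σ₀).toFinset, (([0, 4, 2] : List (Fin 12)).map fun u => ((e.symm u)⁻¹).1 σ₀).toFinset]) ∈
      Submodule.span ℤ {y : CMF (GalT F) conjT →₀ ℤ | ∃ g ∈ 𝒮, ∃ σ : F →+* ℂ,
        y = weightRel g.corner (fun _ => ({σ} : Finset (F →+* ℂ)))} ⊔ pairRel := by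
    refine mem_of_eval_eq_comboVal Γ e hmul hconj σ₀ 𝒮 [(455, 9, 18), (455, 9, 36), (455, 9, 1152), (469, 9, 36)]
      (hreps_kept e σ₀ 𝒮 R₁ R₂ R₄ R₈ hR₁S hR₂S hR₄S hR₈S hR₁ hR₂ hR₄ hR₈)
      [((476, 18, 9), 1), ((924, 576, 1152), -1), ((3640, 36, 9), 1), ((3171, 1152, 576), -1), ((3640, 9, 18), 1),
        ((3640, 1152, 2304), -1), ((1400, 576, 36), 1), ((3171, 36, 18), 1), ((1400, 2304, 576), -1), ((910, 36, 576), -1),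
        ((462, 9, 1152), 1), ((455, 9, 36), 1), ((1372, 576, 36), 1), ((2695, 2304, 576), -1)]
      [(455, -1), (462, -2), (469, -1), (483, -1), (903, 1)]
      (cells_of_check Γ _ _ checks_R₇.1) (pairs_of_check Γ _ checks_R₇.2) _ fun Ψ S hS => ?_
    rw [Finsupp.sub_apply, Finsupp.smul_apply, smul_eq_mul]
    rw [weightRel_corner_apply Γ e hmul hconj R σ₀ hR.1 Ψ hS,
      hR.2.1,
      hR.2.2,
      weightRel_pair_apply Γ e hmul σ₀ E₁ T₃ (by norm_num) (by norm_num) hE₁ hT₃ _ _ hodgeCheck_W₃.1 Ψ hS]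
    exact cert_R₇ S (code_mem_cmTypes Γ e hmul hconj hS)
  exact mem_known_of_sub_mem 𝒮 𝒲 hxy
    (zsmul_weightRel_mem_known 𝒮 𝒲 hW₃
        (isHodgeWeight_pair_of_check Γ e hmul σ₀ E₁ T₃ (by norm_num) (by norm_num) hE₁ hT₃ _ _
          hodgeCheck_W₃.1 hodgeCheck_W₃.2.1 hodgeCheck_W₃.2.2) (1 : ℤ))

end Model

end Summit.HodgeConjecture.CorCM.DuodecicFaceTransport.DihedralMarkman

end
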